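import Literature.NumberTheory.Automorphic.UnitaryGroupTorusCentreLatticeIntegrand
import Literature.NumberTheory.Automorphic.UnitaryGroupKernelClassUnipotentTwo
import Literature.NumberTheory.Automorphic.UnitaryGroupLineUnipotentTwo
import Literature.NumberTheory.Automorphic.UnitaryGroupBorelModulusTwo
import HarnessLib

/-!
# The torus integrand of the line lattice sum of `U(J₂)`: torus conjugation as a dilation of the line by
# `(N_{E/F} d₀)⁻¹`, the re-indexing `N(F) ∖ 1 = E⁻ ∖ 0 = F^*`, and the modulus `δ_B(t) = ‖N_{E/F}(d₀ t)‖_F`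
(Rogawski, *Automorphic Representations of Unitary Groups in Three Variables* (1990), §7.3, proof of Prop. 7.3.1–7.3.2,
(7.3.2) pp. 96–98: «Using the decomposition `G = NMK` and `dg = |δ_B(m)|⁻¹ dn dm dk` … the integral over `𝐙M∖𝐌 → N E^*∖N I_E`
and `N∖𝐍` of `∫_K Σ_{w ∈ E⁰ ∖ {0}} f^K(… n(w) …)`», for `G = U(3)`, `U(2)`, `U(2) × U(1)` alike (p. 98); §7.2 (7.2.3) p. 94:
«`α₃` defines an isomorphism of `MS∖M` with `NE^*∖NI_E` … `Σ_{t∈F^*} ψ(atδ₀)`».)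

Topic `NumberTheory/Automorphic`; namespace `Literature.NumberTheory.Automorphic.UnitaryGroup`. THEOREMS ONLY over accepted
tree modules (no definition, no named fact, no instance, no notation, no `sorry`). H-side copy at `N = 2` (cell
`pub/hodgecm-mathlib`, crux H413, census `CENSUS-LAWS-Hside` §3 (σ-u), row (C-K)_two FILE 1) of ★ (C-K) FILE 1
`UnitaryGroupTorusCentreLatticeIntegrand` (A-p03 (g20), typed at `N = 3` on the CENTRE `n(w)` of the Heisenberg group): at
`N = 2` the unipotent radical of the Borel subgroup of `U(J₂)` IS the line `N(𝔸_F) = {n(b) : b ∈ 𝔸_E⁻}` (★ H-B1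
`UnitaryGroupLineUnipotentTwo`: chart `n(b) = middleRootUnipotent rfl rfl b`, rational points `n(E⁻)`), so the `u`-sum
`Σ'_{u ∈ N(F), u ≠ 1} f(g⁻¹ z₁ u g)` of the bracket of ★ B1_two `truncatedTraceClass_central_eq_add_mul_integral_two` IS a
lattice sum over `E⁻ ∖ 0` — the whole analytic content of Rogawski's Prop. 7.3.1 (b)–(d) at `G = U(2)`.

* §1 THE RE-INDEXING: `exists_equiv_rationalUnipotent_ne_one_two` — `{u ∈ N(F) : u ≠ 1} ≃ {w ∈ E⁻ : w ≠ 0}` along the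
  chart (★ `middleRootUnipotent_mem_rationalUnipotent_iff_two`, `middleCoord`); `tsum_rationalUnipotent_ne_one_eq_tsum_line_two`
  — `Σ'_{u ≠ 1} G(u) = Σ'_{w ≠ 0} G(n(w))` (Mathlib `Equiv.tsum_eq`, no summability needed).
* §2 THE TORUS DILATES THE LINE: `tsum_line_conj_torus_mul_two` — `Σ'_{w ≠ 0} G((t g)⁻¹ (z₁ n(w)) (t g)) =
  Σ'_{w ≠ 0} G(g⁻¹ (z₁ n(λ_t · w)) g)`, `λ_t = d₀⁻¹ d₁` (★ B-p04 `torusConj_middleRootUnipotent_two`; `z₁` central ★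
  `toAdelic_ratCenter_mul_comm_fin`); `inv_mul_diagUnit_one_eq_ideleBaseChange_two` — **`d₀⁻¹ d₁ = ((N_{E∕F} d₀)⁻¹ ⊗ 1)`**
  (★ `torus_relations_two`: `c(d₀) d₁ = 1`; ★ `AdeleRing.ideleBaseChange_ideleRelNorm`) — Rogawski's `α(m)⁻¹ = N(a)⁻¹` for
  `m = d(a, ā⁻¹)`; `smulTraceZero_torus_traceZeroLine_two` — `λ_t · θ(x) = θ((N d₀)⁻¹ · x)`; and the HEAD
  **`tsum_line_conj_torus_mul_eq_tsum_principalIdeles_two`**: for `E/F` quadratic with `c δ = -δ ≠ 0`, `t ∈ T(𝔸_F)`,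
  `g ∈ G(𝔸_F)` and EVERY `G`,
  `Σ'_{u ∈ N(F), u ≠ 1} G((t g)⁻¹ (z₁ u) (t g)) = Σ'_{k ∈ F^*} G(g⁻¹ (z₁ n(θ((k · N(d₀ t))⁻¹))) g)` — B1_two's `u`-sum along
  the torus as a lattice sum over `F^*` in the NORM `N(d₀ t)` (`F^* ≅ principalIdeles F` ★ `principalIdelesEquiv`, composed
  with inversion; `E⁻ ∖ 0 = θ(F^*)` ★ `unitsEquivRationalTraceZeroNeZero`), the shape ★ B-p10 (C-P)_two
  `exists_push_and_integral_tsum_comp_ideleRelNorm_diagUnitZero_eq_two` integrates and Tate's `Σf((N d₀ t)⁻¹)` of ★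
  `lineTorusStage_eq_mul_setIntegral_tateIntegrand_two` reads.
* §3 (K4)_two `torusRootModulus_diagUnit_eq_ideleNorm_ideleRelNorm_two` — **`δ_B(t) = ‖N_{E∕F}(d₀ t)‖_F`** on the torus of
  `U(J₂)` (ONE positive root: ★ `torusRootModulus_two_eq` `δ_B = ‖d₀‖_E`, and `‖d₀‖_E = ‖N d₀‖_F` ★
  `ideleNorm_ideleRelNorm_quadratic`) — versus `‖N(d₀ t)‖_F²` at `N = 3` (★ `torusRootModulus_diagUnit_eq_ideleNorm_ideleRelNorm_sq`):
  the exponent ONE is why the `U(2)` unipotent term carries Tate's TRUNCATED zeta integral at `s = 1` (the `log T` of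
  Prop. 7.3.1 (d)) where the `U(3)` centre-lattice term converged absolutely at `s = 2`.

Letters: `ζ : ratOne F E c` (`z ∈ E¹`), `z₁ ∈ G(F)` with `↑z₁ = ι(ratCenter ζ)`, the chart `n(b) = middleRootUnipotent hij hN
(Multiplicative.ofAdd b)` with the index proofs `hij`, `hN` of ★ H-B1 (`rfl`, `rfl` at the call site), `θ = traceZeroLine F E c hcδ
hδ : 𝔸_F ≃ₜ+ 𝔸_E⁻`, `N = AdeleRing.ideleRelNorm F E`, `d₀ t = diagUnit (↑t).2 0`, `δ_B(t) = torusRootModulus E 2 (diagUnit (↑t).2)`.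

HC_CM is proved only modulo the 7 printed citations until rung 0 closes — nothing here bears on a summit statement.

## References
* J. D. Rogawski, *Automorphic Representations of Unitary Groups in Three Variables*, Ann. of Math. Stud. 123 (1990), §7.3
  (7.3.2) and Prop. 7.3.1–7.3.2 (pp. 96–98); §7.2 (7.2.3) (p. 94); §2.2 (p. 13); §1.10 [Rogawski1990].
* J. W. S. Cassels, A. Fröhlich (eds.), *Algebraic Number Theory* (1967), Ch. II §11, Ch. VII §2 [CasselsFrohlichANT1967].
-/

set_option autoImplicit false

noncomputable section

open MeasureTheory Measure NumberField IsDedekindDomain Topology Set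
open scoped MatrixGroups NNReal ENNReal

namespace Literature.NumberTheory.Automorphic

namespace UnitaryGroup

variable {F E : Type} [Field F] [NumberField F] [Field E] [NumberField E] [Algebra F E]
  {c : E ≃ₐ[F] E}
  (hij : (((0 : Fin 2) : Fin 2) : ℕ) + 1 = (((1 : Fin 2) : Fin 2) : ℕ)) (hN : 2 = 2 * (((0 : Fin 2) : Fin 2) : ℕ) + 2)

variable (ζ : ratOne F E c) {z₁ : (quasiSplit F E c 2).arithmeticSubgroup}

/-! ## §0 Conjugation plumbing -/

section Plumbing

/-- `(x g)⁻¹ (z m) (x g) = g⁻¹ (z (x⁻¹ m x)) g` for `z` central. [folklore] -/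
private theorem conj_mul_of_central₂ {z : (quasiSplit F E c 2).Adelic}
    (hz : ∀ y : (quasiSplit F E c 2).Adelic, z * y = y * z) (x m g : (quasiSplit F E c 2).Adelic) :
    (x * g)⁻¹ * (z * m) * (x * g) = g⁻¹ * (z * (x⁻¹ * m * x)) * g := by
  have h : x⁻¹ * (z * m) * x = z * (x⁻¹ * m * x) := by
    rw [← mul_assoc x⁻¹, ← hz x⁻¹]
    simp only [mul_assoc]
  calc (x * g)⁻¹ * (z * m) * (x * g) = g⁻¹ * (x⁻¹ * (z * m) * x) * g := by group
    _ = g⁻¹ * (z * (x⁻¹ * m * x)) * g := by rw [h]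

/-- `z₁` is central in `U(J₂)(𝔸_F)`: `z₁ y = y z₁` (★ `toAdelic_ratCenter_mul_comm_fin`). [cite: Rogawski1990, §2.2 (p. 13)] -/
theorem coe_center_mul_comm_two
    (hz₁ : (z₁ : (quasiSplit F E c 2).Adelic) =
      (quasiSplit F E c 2).toAdelic (ratCenter F E c 2 ((StdForm.antidiagonal 2).over E) ζ))
    (y : (quasiSplit F E c 2).Adelic) :
    (z₁ : (quasiSplit F E c 2).Adelic) * y = y * (z₁ : (quasiSplit F E c 2).Adelic) := by
  rw [hz₁]; exact toAdelic_ratCenter_mul_comm_fin ζ y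

/-- The coercion of `z₁ u ∈ G(F)` to `G(𝔸_F)` is `↑z₁ · ↑u` (definitional bookkeeping for B1_two's spelling of the
`u`-sum). [cite: Rogawski1990, §7.3 (p. 95)] -/
theorem coe_center_mul_rationalUnipotent_two (u : rationalUnipotent F E c 2) :
    ((z₁ * ⟨(((u : rationalUnipotent F E c 2) : adelicUnipotent F E c 2) : (quasiSplit F E c 2).Adelic),
        (u : rationalUnipotent F E c 2).2⟩ : (quasiSplit F E c 2).arithmeticSubgroup) : (quasiSplit F E c 2).Adelic) =
      (z₁ : (quasiSplit F E c 2).Adelic) *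
        (((u : rationalUnipotent F E c 2) : adelicUnipotent F E c 2) : (quasiSplit F E c 2).Adelic) := rfl

end Plumbing

/-! ## §1 The re-indexing `N(F) ∖ 1 = n(E⁻ ∖ 0)` -/

section Reindex

/-- **`{u ∈ N(F) : u ≠ 1} ≃ {w ∈ E⁻ : w ≠ 0}` ALONG THE CHART `n`**: the rational points of the line `N(𝔸_F)` of `U(J₂)`
are `n(E⁻)` (★ `middleRootUnipotent_mem_rationalUnipotent_iff_two`), `n` is a bijection with inverse `middleCoord` (★
`eq_middleRootUnipotent_two`, `middleCoord_middleRootUnipotent_two`) and `n(0) = 1`. [cite: Rogawski1990, §1.10] -/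
theorem exists_equiv_rationalUnipotent_ne_one_two :
    ∃ e : {u : rationalUnipotent F E c 2 // u ≠ 1} ≃ {w : rationalTraceZero F E c // w ≠ 0},
      ∀ u, (((u.1 : rationalUnipotent F E c 2)) : adelicUnipotent F E c 2) =
        middleRootUnipotent hij hN (Multiplicative.ofAdd ((((e u).1 : rationalTraceZero F E c)) : traceZeroAdele F E c)) := by
  -- the equivalence on the lattices
  let e₀ : rationalUnipotent F E c 2 ≃ rationalTraceZero F E c :=
    { toFun := fun u => ⟨middleCoord hij hN (u : adelicUnipotent F E c 2), middleCoord_mem_rationalTraceZero_two hij hN u.2⟩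
      invFun := fun w => ⟨middleRootUnipotent hij hN (Multiplicative.ofAdd (w : traceZeroAdele F E c)),
        (middleRootUnipotent_mem_rationalUnipotent_iff_two hij hN _).2 w.2⟩
      left_inv := fun u => Subtype.ext (eq_middleRootUnipotent_two hij hN (u : adelicUnipotent F E c 2)).symm
      right_inv := fun w => Subtype.ext (middleCoord_middleRootUnipotent_two hij hN (w : traceZeroAdele F E c)) }
  have he₀ : ∀ u : rationalUnipotent F E c 2, ((e₀ u : rationalTraceZero F E c) : traceZeroAdele F E c) =
      middleCoord hij hN (u : adelicUnipotent F E c 2) := fun u => rfl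
  have hne : ∀ u : rationalUnipotent F E c 2, u ≠ 1 ↔ e₀ u ≠ 0 := by
    intro u
    refine not_congr ⟨fun h => ?_, fun h => ?_⟩
    · refine Subtype.ext ?_
      rw [he₀, h]
      exact middleCoord_one_two hij hN
    · have h' : middleCoord hij hN (u : adelicUnipotent F E c 2) = 0 := by
        rw [← he₀, h]; rfl
      refine Subtype.ext ?_
      change (u : adelicUnipotent F E c 2) = 1
      rw [eq_middleRootUnipotent_two hij hN (u : adelicUnipotent F E c 2), h',
        eq_middleRootUnipotent_two hij hN (1 : adelicUnipotent F E c 2), middleCoord_one_two]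
  refine ⟨e₀.subtypeEquiv hne, fun u => ?_⟩
  change ((u.1 : rationalUnipotent F E c 2) : adelicUnipotent F E c 2) =
    middleRootUnipotent hij hN (Multiplicative.ofAdd (middleCoord hij hN ((u.1 : rationalUnipotent F E c 2) : adelicUnipotent F E c 2)))
  exact eq_middleRootUnipotent_two hij hN _

/-- **`Σ'_{u ∈ N(F), u ≠ 1} G(u) = Σ'_{w ∈ E⁻, w ≠ 0} G(n(w))`** for every `G` on `N(𝔸_F)` of `U(J₂)` (re-indexing along
§1; Mathlib `Equiv.tsum_eq`, no summability needed). [cite: Rogawski1990, §7.3 (pp. 96–98)] -/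
theorem tsum_rationalUnipotent_ne_one_eq_tsum_line_two {M : Type*} [AddCommMonoid M] [TopologicalSpace M]
    (G : adelicUnipotent F E c 2 → M) :
    (∑' u : {u : rationalUnipotent F E c 2 // u ≠ 1}, G ((u.1 : rationalUnipotent F E c 2) : adelicUnipotent F E c 2)) =
      ∑' w : {w : rationalTraceZero F E c // w ≠ 0},
        G (middleRootUnipotent hij hN (Multiplicative.ofAdd (((w.1 : rationalTraceZero F E c)) : traceZeroAdele F E c))) := by
  obtain ⟨e, he⟩ := exists_equiv_rationalUnipotent_ne_one_two (F := F) (E := E) (c := c) hij hN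
  rw [← e.tsum_eq (fun w : {w : rationalTraceZero F E c // w ≠ 0} =>
    G (middleRootUnipotent hij hN (Multiplicative.ofAdd (((w.1 : rationalTraceZero F E c)) : traceZeroAdele F E c))))]
  exact tsum_congr fun u => by rw [← he u]

end Reindex

/-! ## §2 The torus dilates the line variable by `λ_t = d₀⁻¹ d₁ = ((N d₀)⁻¹ ⊗ 1)` -/

section Torus

variable {M : Type*} [AddCommMonoid M] [TopologicalSpace M]

/-- **THE TORUS DILATES THE LINE**: for `t = diag(d) ∈ T(𝔸_F)` of `U(J₂)` and `g ∈ G(𝔸_F)`,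
`Σ'_{w ≠ 0} G((t g)⁻¹ (z₁ n(w)) (t g)) = Σ'_{w ≠ 0} G(g⁻¹ (z₁ n(λ_t · w)) g)`, `λ_t = d₀⁻¹ d₁` (★
`torusConj_middleRootUnipotent_two`; `z₁` central) — Rogawski's «`M` acts on `n(w)` through `α(m)⁻¹`».
[cite: Rogawski1990, §7.3 (pp. 96–98)] [cite: Rogawski1990, §7.2 (p. 94)] -/
theorem tsum_line_conj_torus_mul_two
    (hz₁ : (z₁ : (quasiSplit F E c 2).Adelic) =
      (quasiSplit F E c 2).toAdelic (ratCenter F E c 2 ((StdForm.antidiagonal 2).over E) ζ))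
    (G : (quasiSplit F E c 2).Adelic → M) (t : torusInBorel F E c 2) {d : Fin 2 → (AdeleRing (𝓞 E) E)ˣ}
    (hd : glDiagonal 2 (AdeleRing (𝓞 E) E) d =
      adelicVal F E c 2 _ ((t : borelAdelic F E c 2) : (quasiSplit F E c 2).Adelic))
    (g : (quasiSplit F E c 2).Adelic) :
    (∑' w : {w : rationalTraceZero F E c // w ≠ 0},
      G ((((t : borelAdelic F E c 2) : (quasiSplit F E c 2).Adelic) * g)⁻¹ *
        ((z₁ : (quasiSplit F E c 2).Adelic) *
          ((middleRootUnipotent hij hN (Multiplicative.ofAdd (((w.1 : rationalTraceZero F E c)) : traceZeroAdele F E c)) :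
            adelicUnipotent F E c 2) : (quasiSplit F E c 2).Adelic)) *
        ((((t : borelAdelic F E c 2) : (quasiSplit F E c 2).Adelic)) * g))) =
      ∑' w : {w : rationalTraceZero F E c // w ≠ 0},
        G (g⁻¹ * ((z₁ : (quasiSplit F E c 2).Adelic) *
          ((middleRootUnipotent hij hN (Multiplicative.ofAdd
              (smulTraceZero ((d 0)⁻¹ * d 1) (conjAdele_lineScalar_two t hd)
                (((w.1 : rationalTraceZero F E c)) : traceZeroAdele F E c))) :
            adelicUnipotent F E c 2) : (quasiSplit F E c 2).Adelic)) * g) := by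
  refine tsum_congr fun w => congrArg G ?_
  rw [conj_mul_of_central₂ (coe_center_mul_comm_two ζ hz₁)]
  have h := congrArg (fun v : adelicUnipotent F E c 2 => (v : (quasiSplit F E c 2).Adelic))
    (torusConj_middleRootUnipotent_two hij hN t hd (((w.1 : rationalTraceZero F E c)) : traceZeroAdele F E c))
  simp only [] at h
  rw [← h]

variable [Algebra.IsQuadraticExtension F E] {δ : E}

/-- **The line character is the inverse norm of the first diagonal entry**: for `t = diag(d) ∈ T(𝔸_F)` of the quasi-split
`U(J₂)` of a QUADRATIC `E/F`, `d₀⁻¹ d₁ = ((N_{E/F} d₀)⁻¹ ⊗ 1)` — the torus relation `c(d₀) d₁ = 1` (★ `torus_relations_two`)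
and `(N y)_E = y · c y` (★ `AdeleRing.ideleBaseChange_ideleRelNorm`, ★ `ideleGalNorm_eq_mul_smul_of_apply_eq_neg`). Rogawski:
`α(m)⁻¹ = N(a)⁻¹` for `m = d(a, ā⁻¹)`. [cite: Rogawski1990, §7.2 (p. 94)] [cite: CasselsFrohlichANT1967, Ch. VII §2] -/
theorem inv_mul_diagUnit_one_eq_ideleBaseChange_two (hcδ : c δ = -δ) (hδ : δ ≠ 0) (t : torusInBorel F E c 2)
    {d : Fin 2 → (AdeleRing (𝓞 E) E)ˣ}
    (hd : glDiagonal 2 (AdeleRing (𝓞 E) E) d =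
      adelicVal F E c 2 _ ((t : borelAdelic F E c 2) : (quasiSplit F E c 2).Adelic)) :
    (d 0)⁻¹ * d 1 = AdeleRing.ideleBaseChange F E (AdeleRing.ideleRelNorm F E (d 0))⁻¹ := by
  obtain ⟨-, h01⟩ := torus_relations_two t hd
  have h1 : d 1 = (c • d 0)⁻¹ := by
    refine eq_inv_of_mul_eq_one_right (Units.ext ?_)
    rw [Units.val_mul, val_smul_eq_conjAdele, Units.val_one]
    exact h01
  rw [h1, map_inv, AdeleRing.ideleBaseChange_ideleRelNorm, ideleGalNorm_eq_mul_smul_of_apply_eq_neg c hcδ hδ,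
    ← _root_.mul_inv_rev, mul_comm (c • d 0)]

/-- The dilation by `d₀⁻¹ d₁` read on the line: `λ_t · θ(x) = θ((N d₀)⁻¹ · x)` for every adele `x` of `F`
(`θ(x) = (x ⊗ 1) δ`, ★ `coe_traceZeroLine_mul`). [cite: Rogawski1990, §7.2 (p. 94)] -/
theorem smulTraceZero_torus_traceZeroLine_two (hcδ : c δ = -δ) (hδ : δ ≠ 0) (t : torusInBorel F E c 2)
    {d : Fin 2 → (AdeleRing (𝓞 E) E)ˣ}
    (hd : glDiagonal 2 (AdeleRing (𝓞 E) E) d =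
      adelicVal F E c 2 _ ((t : borelAdelic F E c 2) : (quasiSplit F E c 2).Adelic))
    (x : AdeleRing (𝓞 F) F) :
    smulTraceZero ((d 0)⁻¹ * d 1) (conjAdele_lineScalar_two t hd) (traceZeroLine F E c hcδ hδ x) =
      traceZeroLine F E c hcδ hδ
        ((((AdeleRing.ideleRelNorm F E (d 0))⁻¹ : (AdeleRing (𝓞 F) F)ˣ) : AdeleRing (𝓞 F) F) * x) := by
  refine Subtype.ext ?_
  rw [coe_smulTraceZero, inv_mul_diagUnit_one_eq_ideleBaseChange_two hcδ hδ t hd, AdeleRing.coe_ideleBaseChange,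
    coe_traceZeroLine_mul]

/-- **B1_two's `u`-SUM ALONG THE TORUS AS A LATTICE SUM OVER `F^*` IN THE NORM `N(d₀ t)`**: for `E/F` quadratic with
`c δ = -δ ≠ 0`, `t ∈ T(𝔸_F)` of `U(J₂)`, `g ∈ G(𝔸_F)` and every `G`,
`Σ'_{u ∈ N(F), u ≠ 1} G((t g)⁻¹ (z₁ u) (t g)) = Σ'_{k ∈ F^*} G(g⁻¹ (z₁ n(θ((k · N(d₀ t))⁻¹))) g)`
(§1 re-indexing `N(F) ∖ 1 = n(E⁻ ∖ 0)`; §2 dilation; `E⁻ ∖ 0 = θ(F^*)` ★ `unitsEquivRationalTraceZeroNeZero`;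
`F^* ≅ principalIdeles F` ★ `principalIdelesEquiv`, composed with inversion; `d₀ t = diagUnit (↑t).2 0`) — the summand is a
function of `k • N(d₀ t)`, the shape ★ (C-P)_two `exists_push_and_integral_tsum_comp_ideleRelNorm_diagUnitZero_eq_two`
integrates, and Tate's `Σf` at `(N d₀ t)⁻¹` in ★ `lineTorusStage_eq_mul_setIntegral_tateIntegrand_two`; the `N = 2` twin of ★
`tsum_centre_conj_torus_mul_eq_tsum_principalIdeles`. [cite: Rogawski1990, §7.3 (7.3.2) (pp. 96–98)] [cite: Rogawski1990, §7.2 (7.2.3) (p. 94)] -/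
theorem tsum_line_conj_torus_mul_eq_tsum_principalIdeles_two (hcδ : c δ = -δ) (hδ : δ ≠ 0)
    (hz₁ : (z₁ : (quasiSplit F E c 2).Adelic) =
      (quasiSplit F E c 2).toAdelic (ratCenter F E c 2 ((StdForm.antidiagonal 2).over E) ζ))
    (G : (quasiSplit F E c 2).Adelic → M) (t : torusInBorel F E c 2) (g : (quasiSplit F E c 2).Adelic) :
    (∑' u : {u : rationalUnipotent F E c 2 // u ≠ 1},
      G ((((t : borelAdelic F E c 2) : (quasiSplit F E c 2).Adelic) * g)⁻¹ *
        ((z₁ * ⟨(((u.1 : rationalUnipotent F E c 2) : adelicUnipotent F E c 2) : (quasiSplit F E c 2).Adelic),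
          (u.1 : rationalUnipotent F E c 2).2⟩ : (quasiSplit F E c 2).arithmeticSubgroup) : (quasiSplit F E c 2).Adelic) *
        ((((t : borelAdelic F E c 2) : (quasiSplit F E c 2).Adelic)) * g))) =
      ∑' k : GaloisRepresentations.principalIdeles F,
        G (g⁻¹ * ((z₁ : (quasiSplit F E c 2).Adelic) *
          ((middleRootUnipotent hij hN (Multiplicative.ofAdd
              (traceZeroLine F E c hcδ hδ
                (((k • AdeleRing.ideleRelNorm F E (diagUnit (t : borelAdelic F E c 2).2 0))⁻¹ :
                  (AdeleRing (𝓞 F) F)ˣ) : AdeleRing (𝓞 F) F))) :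
            adelicUnipotent F E c 2) : (quasiSplit F E c 2).Adelic)) * g) := by
  have hd := glDiagonal_diagUnit_torus (F := F) (E := E) (c := c) t
  -- §1: the `u`-sum is the line lattice sum
  have h1 := tsum_rationalUnipotent_ne_one_eq_tsum_line_two (F := F) (E := E) (c := c) hij hN
    (fun v : adelicUnipotent F E c 2 =>
      G ((((t : borelAdelic F E c 2) : (quasiSplit F E c 2).Adelic) * g)⁻¹ *
        ((z₁ : (quasiSplit F E c 2).Adelic) * (v : (quasiSplit F E c 2).Adelic)) *
        ((((t : borelAdelic F E c 2) : (quasiSplit F E c 2).Adelic)) * g)))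
  have h0 : (∑' u : {u : rationalUnipotent F E c 2 // u ≠ 1},
      G ((((t : borelAdelic F E c 2) : (quasiSplit F E c 2).Adelic) * g)⁻¹ *
        ((z₁ * ⟨(((u.1 : rationalUnipotent F E c 2) : adelicUnipotent F E c 2) : (quasiSplit F E c 2).Adelic),
          (u.1 : rationalUnipotent F E c 2).2⟩ : (quasiSplit F E c 2).arithmeticSubgroup) : (quasiSplit F E c 2).Adelic) *
        ((((t : borelAdelic F E c 2) : (quasiSplit F E c 2).Adelic)) * g))) =
      ∑' u : {u : rationalUnipotent F E c 2 // u ≠ 1},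
        G ((((t : borelAdelic F E c 2) : (quasiSplit F E c 2).Adelic) * g)⁻¹ *
          ((z₁ : (quasiSplit F E c 2).Adelic) *
            (((u.1 : rationalUnipotent F E c 2) : adelicUnipotent F E c 2) : (quasiSplit F E c 2).Adelic)) *
          ((((t : borelAdelic F E c 2) : (quasiSplit F E c 2).Adelic)) * g)) :=
    tsum_congr fun u => rfl
  rw [h0, h1, tsum_line_conj_torus_mul_two hij hN ζ hz₁ G t hd g]
  -- `F^* ≃ principalIdeles F`, composed with inversion
  let e' : Fˣ ≃ GaloisRepresentations.principalIdeles F := (Equiv.inv Fˣ).trans (principalIdelesEquiv F).toEquiv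
  have he' : ∀ ξ : Fˣ, ((((e' ξ : GaloisRepresentations.principalIdeles F) •
      AdeleRing.ideleRelNorm F E (diagUnit (t : borelAdelic F E c 2).2 0))⁻¹ : (AdeleRing (𝓞 F) F)ˣ) : AdeleRing (𝓞 F) F) =
      (((AdeleRing.ideleRelNorm F E (diagUnit (t : borelAdelic F E c 2).2 0))⁻¹ : (AdeleRing (𝓞 F) F)ˣ) :
          AdeleRing (𝓞 F) F) * algebraMap F (AdeleRing (𝓞 F) F) (ξ : F) := by
    intro ξ
    have h1 : ((e' ξ : GaloisRepresentations.principalIdeles F) : (AdeleRing (𝓞 F) F)ˣ) =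
        GaloisRepresentations.principalIdele F ξ⁻¹ := rfl
    rw [Subgroup.smul_def, smul_eq_mul, h1, _root_.mul_inv_rev, ← map_inv (GaloisRepresentations.principalIdele F),
      inv_inv, Units.val_mul]
    rfl
  rw [← e'.tsum_eq, ← (unitsEquivRationalTraceZeroNeZero F E c hcδ hδ).tsum_eq]
  refine tsum_congr fun ξ => congrArg G ?_
  rw [coe_unitsEquivRationalTraceZeroNeZero, smulTraceZero_torus_traceZeroLine_two hcδ hδ t hd, he']

end Torus

/-! ## §3 (K4)_two The modulus of the Borel on the torus of `U(J₂)` is the norm of `N(d₀ t)` — power ONE -/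

section Modulus

variable [Algebra.IsQuadraticExtension F E]

/-- **`δ_B(t) = ‖N(d₀ t)‖_F`** on the torus of the quasi-split `U(J₂)` of a quadratic `E/F`: the root modulus
`torusRootModulus E 2 (diagUnit (↑t).2)` (= the modular character of `B(𝔸_F)` at `t`, ★ `modularCharacter_borelAdelic_torus_two`)
is `‖d₀‖_E = ‖N d₀‖_F` (★ `torusRootModulus_two_eq`, Tate's Lemma 4.1.2 ★ `AdeleRing.distribHaarChar_eq_ideleNorm`, ★
`ideleNorm_ideleRelNorm_quadratic`). Rogawski: `δ_B(d(a, ā⁻¹)) = ‖a‖` for `U(2)` (vs `‖a‖²` for `U(3)`).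
[cite: Rogawski1990, §2.2 (p. 13)] [cite: CasselsFrohlichANT1967, Ch. XV Lemma 4.1.2] -/
theorem torusRootModulus_diagUnit_eq_ideleNorm_ideleRelNorm_two [LocallyCompactSpace (AdeleRing (𝓞 E) E)]
    (t : torusInBorel F E c 2) :
    torusRootModulus E 2 (diagUnit (t : borelAdelic F E c 2).2) =
      IdeleClassGroup.ideleNorm F (AdeleRing.ideleRelNorm F E (diagUnit (t : borelAdelic F E c 2).2 0)) := by
  rw [torusRootModulus_two_eq t (glDiagonal_diagUnit_torus t), AdeleRing.distribHaarChar_eq_ideleNorm,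
    ideleNorm_ideleRelNorm_quadratic (F := F) (E := E)]

/-- **`δ_B(t)⁻¹ = ‖N(d₀ t)‖_F⁻¹`** (the weight of the torus stage of ★ (C-G)_two (B)). [cite: Rogawski1990, §2.2 (p. 13)] -/
theorem torusRootModulus_diagUnit_inv_eq_two [LocallyCompactSpace (AdeleRing (𝓞 E) E)]
    (t : torusInBorel F E c 2) :
    ((torusRootModulus E 2 (diagUnit (t : borelAdelic F E c 2).2))⁻¹ : ℝ≥0) =
      (IdeleClassGroup.ideleNorm F (AdeleRing.ideleRelNorm F E (diagUnit (t : borelAdelic F E c 2).2 0)))⁻¹ := by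
  rw [torusRootModulus_diagUnit_eq_ideleNorm_ideleRelNorm_two]

end Modulus

end UnitaryGroup

end Literature.NumberTheory.Automorphic

end
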